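import Summits.KontsevichZagierPeriods.KontsevichZagierPeriods.Theorems.TerasomaMultiplicationBetaCancellationOfAyoubPiCancellation
import Summits.KontsevichZagierPeriods.KontsevichZagierPeriods.Theorems.TerasomaMultiplicationBetaCancellationStubSlabDescent
import Summits.KontsevichZagierPeriods.KontsevichZagierPeriods.Theorems.TerasomaMultiplicationBetaCancellationStubTriangleConst
import Summits.KontsevichZagierPeriods.KontsevichZagierPeriods.Theorems.TerasomaMultiplicationBetaCancellationStubArchimedesTriangle
import Summits.KontsevichZagierPeriods.KontsevichZagierPeriods.Theorems.TerasomaMultiplicationBetaCancellationStubPiMulFibred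

/-!
# Fibred `π`-cancellation in CLOSED-TERM typing: `[π] * c ∈ fibredRelations → c ∈ relations`

Companion of `…FibredPiCancellation.lean` (seat c7, `--supports` stmt-KontsevichZagierPeriods-13633). The
interface typing of item 0540 quantifies over pinned families `P n r : IntegralRep (n + 2)`; the closed
term of `KZProduct.lean` is `of piRep * c` (products `[π] × r : IntegralRep (2 + n)`). We show the two
agree ON THE NOSE — `of piRep * c = FreeAbelianGroup.lift (of ∘ P) c` for the reindexed family
`P n r = ([π] × r).reindex (Fin (2+n) ≃ Fin (n+2))` (`piRep_mul_eq_lift`: transport along `2 + n = n + 2`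
is the relabelling `reindex (finCongr _)`, and `of` cannot see a transport) — and deduce the closed forms

* `fibredPiCancellation : of piRep * c ∈ fibredRelations → c ∈ relations` (registered stub), and
* `piCancellation_iff_mul_fibred : KZ.PiCancellation ↔ ∀ c, of piRep * c ∈ relations → of piRep * c ∈ fibredRelations`.
-/

noncomputable section

-- `Summit.KontsevichZagierPeriods.KontsevichZagierPeriods.…` is the tree's mandated layout (single-conjunct summit).
set_option linter.dupNamespace false

namespace Summit.KontsevichZagierPeriods.KontsevichZagierPeriods.BetaCancellationLine

open Set
open Literature.NumberTheory.Transcendental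
open Literature.NumberTheory.Transcendental.KZ

/-- Transport of a representation along an equality of dimensions is the coordinate relabelling
`reindex (finCongr h)`. [folklore] -/
theorem cast_eq_reindex {a b : ℕ} (h : a = b) (X : IntegralRep a) : h ▸ X = X.reindex (finCongr h) := by
  subst h
  refine IntegralRep.ext' ?_ ?_
  · ext w
    simp [IntegralRep.reindex_domain]
  · funext w
    simp [IntegralRep.reindex_integrand]

/-- `KZ.of` is insensitive to transport along an equality of dimensions. [folklore] -/
theorem of_cast {a b : ℕ} (h : a = b) (X : IntegralRep a) : of (h ▸ X) = of X := by
  subst h; rfl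

/-- **`[π] * c` IS `lift (of ∘ P) c`** for the reindexed pinned family `P n r = ([π] × r).reindex _`,
as elements of `FormalRep` (not merely modulo relations). [folklore] -/
theorem piRep_mul_eq_lift (c : FormalRep) :
    of piRep * c = FreeAbelianGroup.lift
      (fun s : (Σ n, IntegralRep n) => of ((piRep.prod s.2).reindex (finCongr (Nat.add_comm 2 s.1)))) c := by
  induction c using FreeAbelianGroup.induction_on with
  | zero => simp
  | of s =>
    obtain ⟨m, t⟩ := s
    rw [FreeAbelianGroup.lift_apply_of]
    change of piRep * of t = _
    rw [of_mul_of, ← cast_eq_reindex (Nat.add_comm 2 m) (piRep.prod t), of_cast]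
  | neg s ih => rw [mul_neg, map_neg, ih]
  | add x y hx hy => rw [mul_add, map_add, hx, hy]

/-- **FIBRED `π`-CANCELLATION, closed-term form** (registered stub): if `[π] * c` is a fibred relation
(a certificate by moves uniform in the first disc coordinate) then `c` is a relation — slab descent,
Archimedes' trisection and the triangle constant (the three landed stubs). [folklore] -/
theorem fibredPiCancellation :
    ∀ c : FormalRep, of piRep * c ∈ fibredRelations → c ∈ relations := by
  intro c hc
  rw [piRep_mul_eq_lift] at hc
  have hP := fun n r => (⟨piRep_prod_reindex_domain n r, piRep_prod_reindex_integrand n r⟩ :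
    ((piRep.prod r).reindex (finCongr (Nat.add_comm 2 n))).domain =
        {z : Fin (n + 2) → ℝ | z 0 ^ 2 + z 1 ^ 2 ≤ 1 ∧ (fun i : Fin n => z i.succ.succ) ∈ r.domain} ∧
      ((piRep.prod r).reindex (finCongr (Nat.add_comm 2 n))).integrand =
        fun z => r.integrand (fun i : Fin n => z i.succ.succ))
  exact stub_archimedesOfTriangle stub_triangleConst c
    (stub_slabDescent (fun n r => (piRep.prod r).reindex (finCongr (Nat.add_comm 2 n))) hP c (-2) (-1/2) hc)
    (stub_slabDescent (fun n r => (piRep.prod r).reindex (finCongr (Nat.add_comm 2 n))) hP c (-1/2) 2 hc)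

/-- **`KZ.PiCancellation` ⟺ every relation `[π] * c ∈ relations` is a FIBRED relation** (closed-term
form of "0540 ⟺ fibred reduction"; the forward inclusion is `stub_piMulFibred`). [folklore] -/
theorem piCancellation_iff_mul_fibred :
    Literature.NumberTheory.Transcendental.KZ.PiCancellation ↔
      ∀ c : FormalRep, of piRep * c ∈ relations → of piRep * c ∈ fibredRelations := by
  constructor
  · intro h c hc
    have hc' : c ∈ relations := h c hc
    rw [piRep_mul_eq_lift]
    exact stub_piMulFibred (fun n r => (piRep.prod r).reindex (finCongr (Nat.add_comm 2 n)))
      (fun n r => ⟨piRep_prod_reindex_domain n r, piRep_prod_reindex_integrand n r⟩) c hc'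
  · intro h c hc
    exact fibredPiCancellation c (h c hc)

/-- **The crux ⟺ closed-term fibred reduction.** [folklore] -/
theorem betaCancellation_iff_mul_fibred :
    Summit.KontsevichZagierPeriods.KontsevichZagierPeriods.Theses.TerasomaMultiplication.BetaCancellation ↔
      ∀ c : FormalRep, of piRep * c ∈ relations → of piRep * c ∈ fibredRelations :=
  betaCancellation_iff_piCancellation.trans piCancellation_iff_mul_fibred

end Summit.KontsevichZagierPeriods.KontsevichZagierPeriods.BetaCancellationLine
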